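/-
Copyright (c) 2026 the pub-hodgecm-mathlib formalisation cell (harness21).  Prover seat hodgecm-mathlib-K2E5-p17 (g9) (L1 hand dealt to S4 by chair VALVE 12 (c)),
R90-TF §S4 — the (L2) PAYER of the (B1) T-WIF assembly: a BOREL SECTION of the norm map `N : T̃ → T` over each torus (S4 dealer K2E2-plan (g7) DEAL 2026-09-05T01:44Z).
THEOREMS ONLY (no `def`, no `instance`, no notation, no named-fact hypothesis, no `sorry`); NO `Lines` import.
-/
import Summits.HodgeConjecture.HodgeConjecture.Theorems.R90S4CartanNormMap          -- ★ p863295: `exists_mem_centralizer_epsNorm_eq` (§3, `N : T̃ → T` onto)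
import Summits.HodgeConjecture.HodgeConjecture.Theorems.R90S4EpsOrbitalCanonical     -- ★ `continuous_epsLoc`
import Summits.HodgeConjecture.HodgeConjecture.Theorems.R90S4SplitFormGL              -- ★ `splitFormGL` (the form of record as a `GL₃(L)` element)
import Literature.MeasureTheory.RandomSets.MeasurableSelection                       -- ★ Kuratowski–Ryll-Nardzewski `exists_measurable_selector`
import Literature.Topology.Metrizable.LocallyCompactPolish                            -- ★ `polishSpace_of_locallyCompactSpace_of_secondCountableTopology`
import Literature.NumberTheory.Automorphic.LocalUnitaryGroupCongrMeasure               -- ★ `UnitaryGroup.locallyCompactSpace_localGL`, `secondCountableTopology_localGL`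
import HarnessLib

/-!
# R90-TF §S4 — (L2): a BOREL SECTION of the norm map `N(δ) = δ·ε_v(δ)` from `T = Cent_{G_v}(γ)` into `T̃ = Cent_{G̃_v}(γ)`

Cell `hodgecm-mathlib`, crux item h413 = `stmt-HodgeConjecture-24833` (helper lane `--supports … --as helper`, count-neutral); R90-TF squad S4 (dealer K2E2-plan (g7),
DEAL 2026-09-05T01:44:06Z, chair K2-lead VALVE 12 (c)); consumer = R90-C131-p03 (g3)'s (B1-T)∕(B1-Σ) T-WIF assembly, which carries the letter `(s)(hsN)(hsm)` hypothesis-first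
(census `R90/R90-C131-p03/g3/CENSUS-B1-assembly.md` 3ad938c6fc12208c §2 (L2)).

THE MATHEMATICS ([Rogawski1990, §12.5 p. 186; §3.11 Prop. 3.11.1 (a)]; [Kechris1995, Thm. 12.13, Thm. 5.3]).  ★ `exists_mem_centralizer_epsNorm_eq` says the norm map
`N : T̃ → T`, `N(δ) = δ·ε_v(δ)`, is ONTO the torus `T = Cent_{G_v}(γ)` from `T̃ = Cent_{G̃_v}(γ)`.  The Weyl-integration side of the twisted trace formula needs a MEASURABLE choice
`s : T → T̃` with `N(s t) = t` — a Borel section.  It exists by the Kuratowski–Ryll-Nardzewski selection theorem (★ `exists_measurable_selector`) applied to the closed-valued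
correspondence `t ↦ T̃ ∩ N⁻¹{t}` on the Polish space `G̃_v = GL₃(∏_{w∣v} L_w)` (locally compact, second countable, Hausdorff ⇒ Polish, ★
`polishSpace_of_locallyCompactSpace_of_secondCountableTopology`); weak measurability needs NO open-mapping theorem: for `U` open, `{t | (T̃ ∩ N⁻¹{t} ∩ U) ≠ ∅} = g⁻¹(N(T̃ ∩ U))`
and `T̃ ∩ U` is σ-compact (an open subset of an lcsc space is σ-compact; intersect its compact exhaustion with the closed `T̃`), so `N(T̃ ∩ U)` is a countable union of
compact — hence closed, `G̃_v` being Hausdorff — sets, hence Borel.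
* §1 GENERIC **`exists_measurable_section_of_continuous`**: `Y` Polish and locally compact (Borel σ-algebra), `Z` Hausdorff with open sets measurable, `F : Y → Z` continuous,
  `S ⊆ Y` closed, `g : X → Z` measurable with `g x ∈ F '' S` for all `x` ⇒ a MEASURABLE `s : X → Y` with `s x ∈ S` and `F (s x) = g x`.
* §2 THE S4 INSTANCE **`exists_measurable_epsNormSection`**: for `γ ∈ G_v = U(Φ₃)(L⁺_v)` and a subgroup `T ≤ Cent_{G_v}(γ)`, a measurable `s : T → G̃_v` with `s t ∈ Cent_{G̃_v}(γ)`
  and `N(s t) = t` (§1 at `Y := G̃_v`, `S := Cent(γ)`, `F := N`, `g := (t ↦ t)`, `hsurj := ★ exists_mem_centralizer_epsNorm_eq`); **`…_of_form`** — the same for ANY form `Φ`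
  (carrier `(cmDatum L 3 Φ).Local v`); **`…_family`** — a family of tori by `choose`; **`…_of_finset`** — over `C : Finset (Subgroup (Gqs L v))` under the (B1) binder `hZ`
  (each `T ∈ C` the centraliser of a regular element), delivering the generators AND the sections.
HONEST LABEL.  Count-neutral helper: `HC_CM` is proved only modulo the 7 printed citations (2 remaining named inputs: hLiu418 = `stmt-HodgeConjecture-24832`,
h413 = `stmt-HodgeConjecture-24833`) until rung 0 closes; (L2) is one input of (B1) behind the OPEN (W-NP) — a Borel section pays no named input by itself.
-/

set_option autoImplicit false
set_option linter.dupNamespace false -- the mandated namespace repeats `HodgeConjecture.HodgeConjecture`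

noncomputable section

open MeasureTheory Topology Set
open scoped NumberField MatrixGroups

namespace Summit.HodgeConjecture.HodgeConjecture.R90.S4

open Literature.NumberTheory.Rogawski1990 Literature.NumberTheory.Rogawski1990.Ch4Sec10
open Literature.NumberTheory.Automorphic Literature.NumberTheory.Automorphic.UnitaryGroup
open IsDedekindDomain NumberField
open Literature.MeasureTheory.RandomSets (exists_measurable_selector)
open Literature.Topology.Metrizable (polishSpace_of_locallyCompactSpace_of_secondCountableTopology)

/-! ## §1 Generic: a measurable section of a continuous map over a closed set, on a locally compact Polish space -/

/-- **An open subset of a locally compact second countable space, cut by a closed set, is σ-compact**: `IsSigmaCompact (S ∩ U)` for `S` closed, `U` open (the open subspace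
`U` is locally compact and second countable, hence σ-compact; intersect its compact exhaustion with `S`). [cite: Kechris1995, Thm. 5.3] -/
theorem isSigmaCompact_closed_inter_open {Y : Type*} [TopologicalSpace Y] [LocallyCompactSpace Y] [SecondCountableTopology Y]
    {S U : Set Y} (hS : IsClosed S) (hU : IsOpen U) : IsSigmaCompact (S ∩ U) := by
  -- `U` as a space is locally compact and second countable, hence σ-compact
  haveI : LocallyCompactSpace U := hU.isOpenEmbedding_subtypeVal.locallyCompactSpace
  have hUσ : IsSigmaCompact U := isSigmaCompact_iff_sigmaCompactSpace.2 inferInstance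
  obtain ⟨K, hK, hKU⟩ := hUσ
  refine ⟨fun n => S ∩ K n, fun n => (hK n).inter_left hS, ?_⟩
  rw [← inter_iUnion, hKU]

/-- **A MEASURABLE SECTION OF A CONTINUOUS MAP OVER A CLOSED SET** (Kuratowski–Ryll-Nardzewski).  `Y` Polish and locally compact with its Borel σ-algebra, `Z` Hausdorff with
open sets measurable, `F : Y → Z` continuous, `S ⊆ Y` closed, `g : X → Z` measurable with every value attained by `F` on `S`.  THEN there is a MEASURABLE `s : X → Y` with
`s x ∈ S` and `F (s x) = g x` for all `x`.  (★ `exists_measurable_selector` on `Φ x := S ∩ F⁻¹{g x}` — non-empty, closed; weakly measurable because for `U` open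
`{x | (Φ x ∩ U).Nonempty} = g⁻¹(F '' (S ∩ U))` and `F '' (S ∩ U)` is σ-compact (★ `isSigmaCompact_closed_inter_open`), a countable union of compact hence closed sets.)
[cite: Kechris1995, Thm. 12.13; Thm. 5.3] -/
theorem exists_measurable_section_of_continuous {Y Z X : Type*} [TopologicalSpace Y] [PolishSpace Y] [LocallyCompactSpace Y] [MeasurableSpace Y] [BorelSpace Y]
    [TopologicalSpace Z] [T2Space Z] [MeasurableSpace Z] [OpensMeasurableSpace Z] [MeasurableSpace X]
    {F : Y → Z} (hF : Continuous F) {S : Set Y} (hS : IsClosed S) {g : X → Z} (hg : Measurable g) (hsurj : ∀ x, ∃ y ∈ S, F y = g x) :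
    ∃ s : X → Y, Measurable s ∧ ∀ x, s x ∈ S ∧ F (s x) = g x := by
  obtain ⟨s, hsm, hs⟩ := exists_measurable_selector (fun x => S ∩ F ⁻¹' {g x})
    (fun x => by
      obtain ⟨y, hyS, hy⟩ := hsurj x
      exact ⟨y, hyS, hy⟩)
    (fun x => hS.inter (isClosed_singleton.preimage hF))
    (fun U hU => by
      -- `{x | (S ∩ F⁻¹{g x} ∩ U).Nonempty} = g ⁻¹' (F '' (S ∩ U))`, a σ-compact hence measurable set pulled back by `g`
      have hset : {x | (S ∩ F ⁻¹' {g x} ∩ U).Nonempty} = g ⁻¹' (F '' (S ∩ U)) := by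
        ext x
        simp only [mem_setOf_eq, mem_preimage, mem_image, mem_inter_iff]
        constructor
        · rintro ⟨y, ⟨hyS, hy⟩, hyU⟩
          exact ⟨y, ⟨hyS, hyU⟩, hy⟩
        · rintro ⟨y, ⟨hyS, hyU⟩, hy⟩
          exact ⟨y, ⟨hyS, hy⟩, hyU⟩
      rw [hset]
      obtain ⟨K, hK, hKe⟩ := (isSigmaCompact_closed_inter_open hS hU).image hF
      refine hg ?_
      rw [← hKe]
      exact MeasurableSet.iUnion fun n => (hK n).isClosed.measurableSet)
  exact ⟨s, hsm, fun x => ⟨(hs x).1, (hs x).2⟩⟩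

/-! ## §2 The S4 instance: a Borel section of `N : Cent_{G̃_v}(γ) → Cent_{G_v}(γ)` over a torus `T ≤ Cent_{G_v}(γ)` -/

variable (L : Type) [Field L] [NumberField L] [IsCMField L] (v : HeightOneSpectrum (𝓞 ↥(maximalRealSubfield L)))

omit [IsCMField L] in
/-- **`G̃_v = GL₃(∏_{w∣v} L_w)` IS POLISH** (locally compact ★ `UnitaryGroup.locallyCompactSpace_localGL`, second countable ★ `secondCountableTopology_localGL`, Hausdorff ⇒ Polish
★ `polishSpace_of_locallyCompactSpace_of_secondCountableTopology`). [cite: Kechris1995, Thm. 5.3] [cite: PlatonovRapinchuk1994, §3.1] -/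
theorem polishSpace_gtLoc : PolishSpace (GtLoc L v) := by
  haveI : LocallyCompactSpace (GtLoc L v) := UnitaryGroup.locallyCompactSpace_localGL (E := L) 3 v
  haveI : SecondCountableTopology (GtLoc L v) := UnitaryGroup.secondCountableTopology_localGL (E := L) 3 v
  exact polishSpace_of_locallyCompactSpace_of_secondCountableTopology (GtLoc L v)

omit [IsCMField L] in
/-- The centraliser of one element of `G̃_v` is closed (an equaliser in a Hausdorff topological group; Mathlib `Set.isClosed_centralizer`). [cite: Rogawski1990, §3.11 p. 34] -/
theorem isClosed_centralizer_singleton_gtLoc (a : GtLoc L v) : IsClosed ((Subgroup.centralizer ({a} : Set (GtLoc L v)) : Subgroup (GtLoc L v)) : Set (GtLoc L v)) :=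
  Set.isClosed_centralizer _

/-- The norm map `N(δ) = δ·ε_v(δ)` is continuous on `G̃_v` (★ `continuous_epsLoc`). [cite: Rogawski1990, §3.11 p. 34; §4.10 p. 57] -/
theorem continuous_epsNorm_epsLoc (Φ : GL (Fin 3) L) : Continuous (epsNorm (epsLoc L Φ v)) :=
  continuous_id.mul (continuous_epsLoc L Φ v)

/-- **(L2) A BOREL SECTION OF THE NORM MAP OVER A TORUS — ANY HERMITIAN FORM `Φ`.**  For `γ ∈ G_v = U(Φ)(L⁺_v)` and a subgroup `T ≤ Cent_{G_v}(γ)` there is a MEASURABLE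
`s : T → G̃_v` with `s t ∈ Cent_{G̃_v}(γ)` and `N_Φ(s t) = t` for every `t ∈ T` (no regularity, no non-split and no hermitian hypothesis — the generality of ★
`exists_mem_centralizer_epsNorm_eq`): §1 at `Y := G̃_v` (Polish, locally compact), `S := Cent_{G̃_v}(γ)` (closed), `F := N_Φ` (continuous), `g := (t ↦ t ∈ G̃_v)` (continuous ⇒
measurable).  σ-ALGEBRAS: Borel structures on BOTH `G̃_v` and `G_v` are binders; `↥T` carries the structure induced from `G_v`.
[cite: Rogawski1990, §12.5 p. 186; §3.11 Prop. 3.11.1 (a) pp. 34–35] [cite: Kechris1995, Thm. 12.13] -/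
theorem exists_measurable_epsNormSection_of_form (Φ : GL (Fin 3) L)
    [MeasurableSpace (GtLoc L v)] [BorelSpace (GtLoc L v)]
    [MeasurableSpace ((UnitaryGroup.cmDatum L 3 (Φ : Matrix (Fin 3) (Fin 3) L)).Local v)] [BorelSpace ((UnitaryGroup.cmDatum L 3 (Φ : Matrix (Fin 3) (Fin 3) L)).Local v)]
    (γ : (UnitaryGroup.cmDatum L 3 (Φ : Matrix (Fin 3) (Fin 3) L)).Local v) (T : Subgroup ((UnitaryGroup.cmDatum L 3 (Φ : Matrix (Fin 3) (Fin 3) L)).Local v))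
    (hT : (T : Set ((UnitaryGroup.cmDatum L 3 (Φ : Matrix (Fin 3) (Fin 3) L)).Local v)) ⊆ Subgroup.centralizer {γ}) :
    ∃ s : ↥T → GtLoc L v, Measurable s ∧
      ∀ t, s t ∈ Subgroup.centralizer ({(γ.val : GtLoc L v)} : Set (GtLoc L v)) ∧
        epsNorm (epsLoc L Φ v) (s t) = ((t : (UnitaryGroup.cmDatum L 3 (Φ : Matrix (Fin 3) (Fin 3) L)).Local v)).val := by
  haveI : PolishSpace (GtLoc L v) := polishSpace_gtLoc L v
  haveI : LocallyCompactSpace (GtLoc L v) := UnitaryGroup.locallyCompactSpace_localGL (E := L) 3 v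
  -- `t ↦ t.val : ↥T → G_v → G̃_v` is continuous (two subspace inclusions), hence Borel measurable
  have hc : Continuous fun t : ↥T => (((t : (UnitaryGroup.cmDatum L 3 (Φ : Matrix (Fin 3) (Fin 3) L)).Local v)).val : GtLoc L v) :=
    continuous_subtype_val.comp continuous_subtype_val
  obtain ⟨s, hsm, hs⟩ := exists_measurable_section_of_continuous (X := ↥T) (continuous_epsNorm_epsLoc L v Φ)
    (isClosed_centralizer_singleton_gtLoc L v (γ.val : GtLoc L v)) hc.measurable fun t =>
      exists_mem_centralizer_epsNorm_eq L Φ v γ (hT t.2)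
  exact ⟨s, hsm, hs⟩

/-- **(L2) A BOREL SECTION OF THE NORM MAP OVER A TORUS — THE FORM OF RECORD.**  For `γ ∈ G_v = U(Φ₃)(L⁺_v)` (carrier `Gqs L v`, form ★ `splitFormGL L`) and a subgroup
`T ≤ Cent_{G_v}(γ)` there is a MEASURABLE `s : T → G̃_v` with `s t ∈ Cent_{G̃_v}(γ)` and `N(s t) = t` for every `t ∈ T` (no regularity, no non-split hypothesis): §1 at
`Y := G̃_v` (Polish, locally compact), `S := Cent_{G̃_v}(γ)` (closed), `F := N` (continuous), `g := (t ↦ t ∈ G̃_v)` (continuous ⇒ measurable), every value attained by ★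
`exists_mem_centralizer_epsNorm_eq` (Prop. 3.11.1 (a): `1 → Z̃T̃ᴺ → T̃ → T → 1` exact).  σ-ALGEBRAS (consumer frame of ★ `IsStableTwistedWeylMeasure`): Borel structures on
BOTH `G̃_v` and `G_v` are binders; `↥T` carries the structure induced from `G_v` (the carrier `Gqs L v` does not unfold to a subtype of `G̃_v` at instance transparency, so there
is no competing instance; proved directly on the `Gqs` carrier — `Φ` is never inferred from a `Gqs`-typed term).
[cite: Rogawski1990, §12.5 p. 186; §3.11 Prop. 3.11.1 (a) pp. 34–35] [cite: Kechris1995, Thm. 12.13] -/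
theorem exists_measurable_epsNormSection [MeasurableSpace (GtLoc L v)] [BorelSpace (GtLoc L v)] [MeasurableSpace (Gqs L v)] [BorelSpace (Gqs L v)]
    (γ : Gqs L v) (T : Subgroup (Gqs L v)) (hT : (T : Set (Gqs L v)) ⊆ Subgroup.centralizer {γ}) :
    ∃ s : ↥T → GtLoc L v, Measurable s ∧
      ∀ t, s t ∈ Subgroup.centralizer ({(γ.val : GtLoc L v)} : Set (GtLoc L v)) ∧ epsNorm (epsLoc L (splitFormGL L) v) (s t) = ((t : Gqs L v)).val := by
  haveI : PolishSpace (GtLoc L v) := polishSpace_gtLoc L v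
  haveI : LocallyCompactSpace (GtLoc L v) := UnitaryGroup.locallyCompactSpace_localGL (E := L) 3 v
  -- `t ↦ t.val : ↥T → G_v → G̃_v` is continuous (two subspace inclusions), hence Borel measurable
  have hc : Continuous fun t : ↥T => (((t : Gqs L v)).val : GtLoc L v) := continuous_subtype_val.comp continuous_subtype_val
  have hg : Measurable fun t : ↥T => (((t : Gqs L v)).val : GtLoc L v) := hc.measurable
  obtain ⟨s, hsm, hs⟩ := exists_measurable_section_of_continuous (X := ↥T) (continuous_epsNorm_epsLoc L v (splitFormGL L))
    (isClosed_centralizer_singleton_gtLoc L v (γ.val : GtLoc L v)) hg fun t =>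
      exists_mem_centralizer_epsNorm_eq L (splitFormGL L) v γ (hT t.2)
  exact ⟨s, hsm, hs⟩

/-- **(L2) FOR A FAMILY OF TORI** (the (B1) assembly's shape over a finite or arbitrary index of subgroups): for tori `T i ≤ Cent_{G_v}(γ i)` there is a family of measurable sections
`s i : T i → G̃_v` with `s i t ∈ Cent_{G̃_v}(γ i)` and `N(s i t) = t` (`choose` over `exists_measurable_epsNormSection`). [cite: Rogawski1990, §12.5 p. 186; §3.11 Prop. 3.11.1 (a)] -/
theorem exists_measurable_epsNormSection_family [MeasurableSpace (GtLoc L v)] [BorelSpace (GtLoc L v)] [MeasurableSpace (Gqs L v)] [BorelSpace (Gqs L v)]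
    {ι : Type*} (γ : ι → Gqs L v) (T : ι → Subgroup (Gqs L v)) (hT : ∀ i, (T i : Set (Gqs L v)) ⊆ Subgroup.centralizer {γ i}) :
    ∃ s : ∀ i, ↥(T i) → GtLoc L v, (∀ i, Measurable (s i)) ∧
      ∀ i t, s i t ∈ Subgroup.centralizer ({((γ i).val : GtLoc L v)} : Set (GtLoc L v)) ∧ epsNorm (epsLoc L (splitFormGL L) v) (s i t) = ((t : Gqs L v)).val := by
  choose s hsm hs using fun i => exists_measurable_epsNormSection L v (γ i) (T i) (hT i)
  exact ⟨s, hsm, hs⟩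

/-- **(L2) OVER A FINITE SET OF CARTANS, `hZ`-SHAPED** (the (B1) assembly's binder ★ `hZ` verbatim: every `T ∈ C` is the centraliser of a regular element): regular generators
`γ i` with `T_i = Cent_{G_v}(γ i)` and measurable sections `s i : T_i → G̃_v` with `s i t ∈ Cent_{G̃_v}(γ i)` and `N(s i t) = t` — `choose` the generators, then ★
`exists_measurable_epsNormSection_family`. [cite: Rogawski1990, §12.5 p. 186; §3.11 Prop. 3.11.1 (a)] -/
theorem exists_measurable_epsNormSection_of_finset [MeasurableSpace (GtLoc L v)] [BorelSpace (GtLoc L v)] [MeasurableSpace (Gqs L v)] [BorelSpace (Gqs L v)]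
    (C : Finset (Subgroup (Gqs L v)))
    (hZ : ∀ T ∈ C, ∃ γ₀ : Gqs L v, IsRegularElt (γ₀.val : GL (Fin 3) (LocalRing L v)) ∧ T = Subgroup.centralizer ({γ₀} : Set (Gqs L v))) :
    ∃ (γ : ↥C → Gqs L v) (s : ∀ i : ↥C, ↥(i : Subgroup (Gqs L v)) → GtLoc L v),
      (∀ i : ↥C, IsRegularElt ((γ i).val : GL (Fin 3) (LocalRing L v)) ∧ (i : Subgroup (Gqs L v)) = Subgroup.centralizer ({γ i} : Set (Gqs L v))) ∧
      (∀ i, Measurable (s i)) ∧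
      ∀ i t, s i t ∈ Subgroup.centralizer ({((γ i).val : GtLoc L v)} : Set (GtLoc L v)) ∧ epsNorm (epsLoc L (splitFormGL L) v) (s i t) = ((t : Gqs L v)).val := by
  choose γ hreg hTeq using hZ
  obtain ⟨s, hsm, hs⟩ := exists_measurable_epsNormSection_family L v (fun i : ↥C => γ i i.2) (fun i : ↥C => (i : Subgroup (Gqs L v)))
    fun i => (hTeq i i.2).le
  exact ⟨fun i => γ i i.2, s, fun i => ⟨hreg i i.2, hTeq i i.2⟩, hsm, hs⟩

end Summit.HodgeConjecture.HodgeConjecture.R90.S4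

end
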